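import Summits.ValiantsHypothesis.ValiantsHypothesis.Theorems.BarrierLeverChowHitsPartitionMinorsRHybridColumns
import Summits.ValiantsHypothesis.ValiantsHypothesis.Theorems.BarrierLeverChowHitsPartitionMinorsRHybridLeading
import Summits.ValiantsHypothesis.ValiantsHypothesis.Theorems.BarrierLeverChowHitsPartitionMinorsRFacePrivateDesign

/-!
# Route BarrierLever — item `ChowHitsPartitionMinorsR` (stmt-ValiantsHypothesis-21882):
# THEOREM H — EVERY EQUAL-SIZE LOWER-SET PAIR IS HIT BY `h + ‖C∖R‖` AFFINE FORMS (the hybrid design)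

Helper file (`--supports stmt-ValiantsHypothesis-21882`; cell valiant-natproofs, rung V4, 𝒟-side support item of route
BarrierLever; prover seat val-np-p5 gen 32; seat memo MEMO-21882-valnp5-g32.md §6, kernel step K-H6 = assembly). Closes NO item.

**THEOREM H (`chowHits_of_hybrid`).** Let `u, w : Fin r → Finset (Fin h)` be injective with LOWER-SET ranges (so `|R| = |C| = r`).
Then some product of `h + Σ_{j : w j ∉ range u} |w j|` affine forms — the `h` base forms `1 + x_a + y_a` and, for every DEFECT
column `w j ∉ R`, the face-private rotated group of `|w j|` forms `1 − X_{u(σ j)} + ζ^k s_j Y_{w j}` — has non-vanishing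
partition minor on `(u, w)`. Assembly: `…RHybridBase` (p732352: pure forms free, base `≡ ∏(1 − x_a y_a)`), `…RHybridColumns`
(column structure `(A + X·ρ)·diag(1 | X^{m j})` for the size-graded scaling `m j = h!(2h+1−|w j|)`), `…RHybridLeading`
(`det A ≠ 0`), and THEOREM FP's `det_ne_zero_of_columns` / root-of-unity groups (p712585 chain).

CONSEQUENCE (memo §6): with `chow_hit_swap_fin`, every injective equal-size lower pair is hit by
`h + min(‖R∖C‖, ‖C∖R‖)` forms; inside the registered lower-set node's budget `m + 2h ≤ h·h` whenever one defect mass is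
`≤ h·h − 3h`. The arrows and node texts are in the companion file `…RHybridArrow`.

WHAT THIS IS NOT: item 21882 (ALL layouts, budget `h·h`) is NOT proved — pairs with both defect masses `> h·h − 3h` remain;
nothing on crux stmt-ValiantsHypothesis-14610 or on `VP` versus `VNP`.
-/

set_option linter.dupNamespace false

namespace Summit.ValiantsHypothesis.ValiantsHypothesis.Theorems.BarrierLever.ChowHybrid

open Finset MvPolynomial
open Summit.ValiantsHypothesis.ValiantsHypothesis.Theorems.BarrierLever.ChowShift (pmat)
open Summit.ValiantsHypothesis.ValiantsHypothesis.Theorems.BarrierLever.ChowFacePrivate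
  (coeff_partitionExpo_designGroup coeff_partitionExpo_one_add_C_mul_sumX_pow det_ne_zero_of_columns
    exists_root_const neg_neg_C_mul_X_pow_pow totalDegree_map_affine_le exists_row_of_subset)

noncomputable section

variable {h r : ℕ}

/-! ## 1. Small ingredients -/

/-- A permutation labelling every COMMON column (a column that is also a row) by its row. -/
theorem exists_perm_common (u w : Fin r → Finset (Fin h)) (hu : Function.Injective u) (hw : Function.Injective w) :
    ∃ σ : Equiv.Perm (Fin r), ∀ j, (∃ i, u i = w j) → u (σ j) = w j := by
  classical
  let p : Fin r → Prop := fun j => ∃ i, u i = w j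
  let q : Fin r → Prop := fun i => ∃ j, w j = u i
  let e : {j // p j} ≃ {i // q i} :=
    { toFun := fun j => ⟨Classical.choose j.2, ⟨j.1, (Classical.choose_spec j.2).symm⟩⟩
      invFun := fun i => ⟨Classical.choose i.2, ⟨i.1, (Classical.choose_spec i.2).symm⟩⟩
      left_inv := by
        rintro ⟨j, hj⟩
        apply Subtype.ext
        apply hw
        have h1 := Classical.choose_spec hj
        have h2 := Classical.choose_spec (⟨j, (Classical.choose_spec hj).symm⟩ : q (Classical.choose hj))
        exact h2.trans h1
      right_inv := by
        rintro ⟨i, hi⟩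
        apply Subtype.ext
        apply hu
        have h1 := Classical.choose_spec hi
        have h2 := Classical.choose_spec (⟨i, (Classical.choose_spec hi).symm⟩ : p (Classical.choose hi))
        exact h2.trans h1 }
  refine ⟨e.extendSubtype, fun j hj => ?_⟩
  rw [Equiv.extendSubtype_apply_of_mem e j hj]
  exact Classical.choose_spec hj

/-- The base form `1 + x_a + y_a` is affine. -/
theorem totalDegree_baseForm_le {S : Type*} [CommRing S] [Nontrivial S] (a : Fin h) :
    (baseForm a : MvPolynomial (Fin (h + h)) S).totalDegree ≤ 1 := by
  unfold baseForm
  refine (totalDegree_add _ _).trans (max_le ((totalDegree_add _ _).trans (max_le ?_ ?_)) ?_)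
  · rw [totalDegree_one]; exact zero_le_one
  · exact (totalDegree_X _).le
  · exact (totalDegree_X _).le

/-- The base form is defined over every coefficient ring compatibly. -/
theorem map_baseForm {S T : Type*} [CommRing S] [CommRing T] (f : S →+* T) (a : Fin h) :
    MvPolynomial.map f (baseForm a : MvPolynomial (Fin (h + h)) S) = baseForm a := by
  unfold baseForm
  simp only [map_add, map_one, map_X]

/-! ## 2. THEOREM H -/

/-- **THEOREM H (hybrid design).** For injective `u, w` with lower-set ranges, some product of
`h + Σ_{defect j} |w j|` affine forms has a nonzero partition minor on `(u, w)`. -/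
theorem chowHits_of_hybrid (u w : Fin r → Finset (Fin h)) (hu : Function.Injective u) (hw : Function.Injective w)
    (hlu : IsLowerSet (Set.range u)) (hlw : IsLowerSet (Set.range w)) :
    ∃ ℓ : Fin (h + ∑ j : {j : Fin r // ¬ ∃ i, u i = w j}, (w j.1).card) → MvPolynomial (Fin (h + h)) ℂ,
      (∀ k, (ℓ k).totalDegree ≤ 1) ∧
      (Matrix.of fun i j : Fin r => MvPolynomial.coeff (∑ a ∈ u i, Finsupp.single (Fin.castAdd h a) 1 +
          ∑ c ∈ w j, Finsupp.single (Fin.natAdd h c) 1) (∏ k, ℓ k)).det ≠ 0 := by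
  classical
  -- labels and predicates
  set z : Fin r → Prop := fun j => ∃ i, u i = w j with hzdef
  obtain ⟨σ, hσ⟩ := exists_perm_common u w hu hw
  have hlow : ∀ i S, S ⊆ u i → ∃ k, u k = S := fun i S hS => exists_row_of_subset u hlu i S hS
  set n : Fin r → ℕ := fun j => (w j).card with hndef
  have hn_le : ∀ j, n j ≤ h := fun j => (Finset.card_le_univ _).trans (Fintype.card_fin h).le
  -- defect columns are nonempty (the empty set is a row as soon as there is a row)
  have hn0 : ∀ j, ¬ z j → n j ≠ 0 := by
    intro j hj h0
    apply hj
    have hwj : w j = ∅ := Finset.card_eq_zero.mp h0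
    obtain ⟨k, hk⟩ := hlow j ∅ (Finset.empty_subset _)
    exact ⟨k, hk.trans hwj.symm⟩
  -- size-graded exponents
  set L : ℕ := h.factorial with hL
  have hLpos : 0 < L := Nat.factorial_pos h
  set m : Fin r → ℕ := fun j => L * (2 * h + 1 - n j) with hmdef
  set M : ℕ := L * (h + 1) with hMdef
  have hM1 : 1 ≤ M := by rw [hMdef]; nlinarith
  have hmM : ∀ j, ¬ z j → M ≤ m j := by
    intro j _
    rw [hmdef, hMdef]
    exact Nat.mul_le_mul_left L (by have := hn_le j; omega)
  have hm2 : ∀ j, ¬ z j → m j + 1 ≤ 2 * M := by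
    intro j _
    rw [hmdef, hMdef]
    have : 2 * h + 1 - n j ≤ 2 * h + 1 := Nat.sub_le _ _
    nlinarith [Nat.mul_le_mul_left L this]
  have hmono : ∀ j j', ¬ z j → ¬ z j' → (w j').card < (w j).card → m j + 1 ≤ m j' := by
    intro j j' _ _ hlt
    rw [hmdef]
    have h1 : 2 * h + 1 - n j + 1 ≤ 2 * h + 1 - n j' := by
      have e1 : n j = (w j).card := rfl
      have e2 : n j' = (w j').card := rfl
      have := hn_le j; have := hn_le j'; omega
    calc L * (2 * h + 1 - n j) + 1 ≤ L * (2 * h + 1 - n j) + L := by omega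
      _ = L * (2 * h + 1 - n j + 1) := by ring
      _ ≤ L * (2 * h + 1 - n j') := Nat.mul_le_mul_left L h1
  have hdvd : ∀ j, ¬ z j → n j ∣ m j := fun j hj =>
    (Nat.dvd_factorial (Nat.pos_of_ne_zero (hn0 j hj)) (hn_le j)).mul_right _
  -- roots of unity and scaling constants
  have hζ : ∀ j, ¬ z j → IsPrimitiveRoot (Complex.exp (2 * Real.pi * Complex.I / (n j))) (n j) := fun j hj =>
    Complex.isPrimitiveRoot_exp _ (hn0 j hj)
  have hρex : ∀ j : Fin r, ∃ ρ : ℂ, ¬ z j → -((-ρ) ^ (n j) * ((n j).factorial : ℂ)) = 1 := by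
    intro j
    by_cases hj : z j
    · exact ⟨0, fun hh => absurd hj hh⟩
    · obtain ⟨ρ, hρ⟩ := exists_root_const (n j) (Nat.pos_of_ne_zero (hn0 j hj))
      exact ⟨ρ, fun _ => hρ⟩
  choose ρ hρ using hρex
  have hs : ∀ j, ¬ z j →
      -((-(Polynomial.C (ρ j) * Polynomial.X ^ (m j / n j))) ^ (n j) * ((n j).factorial : Polynomial ℂ)) =
        Polynomial.X ^ (m j) := fun j hj => neg_neg_C_mul_X_pow_pow (ρ j) (hdvd j hj) (hρ j hj)
  -- the forms over `ℂ[X]`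
  set formP : Fin r → ℕ → MvPolynomial (Fin (h + h)) (Polynomial ℂ) := fun j k =>
    (1 + C (-1 : Polynomial ℂ) * ∑ a ∈ u (σ j), X (Fin.castAdd h a)) +
      C (algebraMap ℂ (Polynomial ℂ) (Complex.exp (2 * Real.pi * Complex.I / (n j)) ^ k) *
        (Polynomial.C (ρ j) * Polynomial.X ^ (m j / n j))) * ∑ c ∈ w j, X (Fin.natAdd h c) with hformP
  set QP : Fin r → MvPolynomial (Fin (h + h)) (Polynomial ℂ) := fun j =>
    (1 + C (-1 : Polynomial ℂ) * ∑ a ∈ u (σ j), X (Fin.castAdd h a)) ^ (n j) with hQP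
  -- the groups of the defect columns, indexed by the subtype
  set D := {j : Fin r // ¬ z j}
  set G : D → MvPolynomial (Fin (h + h)) (Polynomial ℂ) := fun j => ∏ k ∈ Finset.range (n j.1), formP j.1 k with hGdef
  set Q : D → MvPolynomial (Fin (h + h)) (Polynomial ℂ) := fun j => QP j.1 with hQdef
  have hGQ : ∀ (j : D) (S T : Finset (Fin h)),
      coeff (∑ a ∈ S, Finsupp.single (Fin.castAdd h a) 1 + ∑ c ∈ T, Finsupp.single (Fin.natAdd h c) 1) (G j) =
      coeff (∑ a ∈ S, Finsupp.single (Fin.castAdd h a) 1 + ∑ c ∈ T, Finsupp.single (Fin.natAdd h c) 1) (Q j) +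
        (if S = ∅ ∧ T = w j.1 then (Polynomial.X : Polynomial ℂ) ^ (m j.1) else 0) := fun j S T =>
    coeff_partitionExpo_designGroup (hn0 j.1 j.2) (hζ j.1 j.2) (u (σ j.1)) (w j.1) rfl _ _ (hs j.1 j.2) S T
  have hQT : ∀ (j : D) (S T : Finset (Fin h)), T ≠ ∅ →
      coeff (∑ a ∈ S, Finsupp.single (Fin.castAdd h a) 1 + ∑ c ∈ T, Finsupp.single (Fin.natAdd h c) 1) (Q j) = 0 := by
    intro j S T hT
    rw [hQdef, hQP]
    simp only
    rw [coeff_partitionExpo_one_add_C_mul_sumX_pow, if_neg (fun hh => hT hh.1)]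
  -- the column structure of the normalised product
  have hcol := hybrid_columns u w hw hlu z (fun j => Iff.rfl) (Polynomial.X : Polynomial ℂ) M m hM1 hmM hm2 hmono
    G Q hQT hGQ
  -- the leading matrix over `ℂ`
  set Qc : Fin r → MvPolynomial (Fin (h + h)) ℂ := fun j' =>
    (1 + C (-1 : ℂ) * ∑ a ∈ u (σ j'), X (Fin.castAdd h a)) ^ (n j') with hQc
  set A : Matrix (Fin r) (Fin r) ℂ := Matrix.of fun i j : Fin r =>
      if z j then
        (-1 : ℂ) ^ (w j).card * (if w j ⊆ u i then coeff (∑ a ∈ u i \ w j, Finsupp.single (Fin.castAdd h a) 1 +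
          ∑ c ∈ (∅ : Finset (Fin h)), Finsupp.single (Fin.natAdd h c) 1)
          (∏ j' ∈ (Finset.univ : Finset (Fin r)).filter (fun j' => ¬ z j'), Qc j') else 0)
      else coeff (∑ a ∈ u i, Finsupp.single (Fin.castAdd h a) 1 +
          ∑ c ∈ (∅ : Finset (Fin h)), Finsupp.single (Fin.natAdd h c) 1)
        (∏ j' ∈ ((Finset.univ : Finset (Fin r)).filter (fun j' => ¬ z j')).erase j, Qc j') with hAdef
  have hAdet : A.det ≠ 0 := det_leadingHybrid_ne_zero u w hu hlow σ z hσ n hn0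
  -- products over the subtype versus filtered products
  have hQmap : ∀ j', QP j' = MvPolynomial.map Polynomial.C (Qc j') := by
    intro j'
    simp only [hQP, hQc, map_pow, map_add, map_one, map_mul, map_sum, map_X, map_neg]
  have himg_univ : (Finset.univ : Finset D).image Subtype.val = (Finset.univ : Finset (Fin r)).filter (fun j' => ¬ z j') := by
    ext x
    simp only [Finset.mem_image, Finset.mem_univ, true_and, Finset.mem_filter, Subtype.exists, exists_prop,
      exists_eq_right]
  have himg_erase : ∀ (j : Fin r) (hj : ¬ z j),
      ((Finset.univ : Finset D).erase ⟨j, hj⟩).image Subtype.val =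
        ((Finset.univ : Finset (Fin r)).filter (fun j' => ¬ z j')).erase j := by
    intro j hj
    ext x
    simp only [Finset.mem_image, Finset.mem_erase, Finset.mem_univ, Finset.mem_filter, true_and, and_true,
      Subtype.exists, exists_prop, ne_eq, Subtype.mk.injEq]
    constructor
    · rintro ⟨a, ha, ⟨hne, rfl⟩⟩
      exact ⟨hne, ha⟩
    · rintro ⟨hne, hx⟩
      exact ⟨x, hx, hne, rfl⟩
  have hprodQ : (∏ j' : D, Q j') = MvPolynomial.map Polynomial.C
      (∏ j' ∈ (Finset.univ : Finset (Fin r)).filter (fun j' => ¬ z j'), Qc j') := by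
    rw [map_prod, ← himg_univ, Finset.prod_image (fun a _ b _ e => Subtype.ext e)]
    exact Finset.prod_congr rfl fun j' _ => hQmap j'.1
  have hprodQerase : ∀ (j : Fin r) (hj : ¬ z j), (∏ j' ∈ (Finset.univ : Finset D).erase ⟨j, hj⟩, Q j') =
      MvPolynomial.map Polynomial.C (∏ j' ∈ ((Finset.univ : Finset (Fin r)).filter (fun j' => ¬ z j')).erase j, Qc j') := by
    intro j hj
    rw [map_prod, ← himg_erase j hj, Finset.prod_image (fun a _ b _ e => Subtype.ext e)]
    exact Finset.prod_congr rfl fun j' _ => hQmap j'.1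
  have hAentry : ∀ i j, Polynomial.C (A i j) =
      (if hj : z j then
          (-1 : Polynomial ℂ) ^ (w j).card * (if w j ⊆ u i then coeff (∑ a ∈ u i \ w j, Finsupp.single (Fin.castAdd h a) 1 +
            ∑ c ∈ (∅ : Finset (Fin h)), Finsupp.single (Fin.natAdd h c) 1) (∏ j', Q j') else 0)
        else coeff (∑ a ∈ u i, Finsupp.single (Fin.castAdd h a) 1 +
            ∑ c ∈ (∅ : Finset (Fin h)), Finsupp.single (Fin.natAdd h c) 1)
          (∏ j' ∈ (Finset.univ : Finset D).erase ⟨j, hj⟩, Q j')) := by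
    intro i j
    rw [hAdef, Matrix.of_apply]
    by_cases hj : z j
    · rw [if_pos hj, dif_pos hj, hprodQ, coeff_map]
      by_cases hsub : w j ⊆ u i
      · rw [if_pos hsub, if_pos hsub, map_mul, map_pow, map_neg, map_one]
      · rw [if_neg hsub, if_neg hsub, mul_zero, mul_zero, map_zero]
    · rw [if_neg hj, dif_neg hj, hprodQerase j hj, coeff_map]
  -- the normalised product has nonzero determinant over `ℂ[X]`
  have hdet_norm : (pmat u w ((∏ a, (phi a : MvPolynomial (Fin (h + h)) (Polynomial ℂ))) * ∏ j', G j')).det ≠ 0 := by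
    refine det_ne_zero_of_columns A hAdet _ (Polynomial.X : Polynomial ℂ) (by rw [Polynomial.eval_X])
      (fun j => if z j then 1 else Polynomial.X ^ (m j)) (fun j => ?_) (fun i j => ?_)
    · by_cases hj : z j
      · simp only [hj, if_true]; exact one_ne_zero
      · simp only [hj, if_false]; exact pow_ne_zero _ Polynomial.X_ne_zero
    · obtain ⟨ρ', hρ'⟩ := hcol i j
      refine ⟨ρ', ?_⟩
      rw [ChowShift.pmat_apply, hρ', hAentry i j]
  -- back to the true base forms
  have hdet : (pmat u w ((∏ a, (baseForm a : MvPolynomial (Fin (h + h)) (Polynomial ℂ))) * ∏ j', G j')).det ≠ 0 := by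
    rw [det_pmat_base_mul u w hu hw hlu hlw]; exact hdet_norm
  -- a complex evaluation point where the determinant does not vanish
  obtain ⟨x₀, hx₀⟩ : ∃ x₀ : ℂ, Polynomial.eval x₀
      (pmat u w ((∏ a, (baseForm a : MvPolynomial (Fin (h + h)) (Polynomial ℂ))) * ∏ j', G j')).det ≠ 0 := by
    by_contra hall
    exact hdet (Polynomial.funext fun x => by
      rw [Polynomial.eval_zero]; exact not_not.mp fun hx => hall ⟨x, hx⟩)
  -- the index type of the design and its enumeration
  set form : (Fin h ⊕ (Σ j : D, Fin (n j.1))) → MvPolynomial (Fin (h + h)) (Polynomial ℂ) :=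
    Sum.elim (fun a => (baseForm a : MvPolynomial (Fin (h + h)) (Polynomial ℂ)))
      (fun p : (Σ j : D, Fin (n j.1)) => formP p.1.1 (p.2 : ℕ)) with hform
  have hcard : Fintype.card (Fin h ⊕ (Σ j : D, Fin (n j.1))) = h + ∑ j : D, (w j.1).card := by
    rw [Fintype.card_sum, Fintype.card_fin, Fintype.card_sigma]
    simp only [Fintype.card_fin]
    rfl
  set e : (Fin h ⊕ (Σ j : D, Fin (n j.1))) ≃ Fin (h + ∑ j : D, (w j.1).card) :=
    (Fintype.equivFin _).trans (finCongr hcard) with he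
  have hprodform : (∏ q : (Fin h ⊕ (Σ j : D, Fin (n j.1))), form q) =
      (∏ a, (baseForm a : MvPolynomial (Fin (h + h)) (Polynomial ℂ))) * ∏ j', G j' := by
    rw [Fintype.prod_sum_type]
    simp only [hform, Sum.elim_inl, Sum.elim_inr]
    congr 1
    rw [Fintype.prod_sigma]
    refine Finset.prod_congr rfl fun j _ => ?_
    rw [hGdef]
    exact Fin.prod_univ_eq_prod_range (fun k => formP j.1 k) (n j.1)
  refine ⟨fun q => MvPolynomial.map (Polynomial.evalRingHom x₀) (form (e.symm q)), fun q => ?_, ?_⟩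
  · -- affine
    show (MvPolynomial.map (Polynomial.evalRingHom x₀) (form (e.symm q))).totalDegree ≤ 1
    obtain ⟨x, hx⟩ : ∃ x, e.symm q = x := ⟨_, rfl⟩
    rw [hx]
    rcases x with a | ⟨j, k⟩
    · simp only [hform, Sum.elim_inl]
      rw [map_baseForm]; exact totalDegree_baseForm_le a
    · simp only [hform, Sum.elim_inr]
      exact totalDegree_map_affine_le _ _ _ _ _
  · have hprod : (∏ q, MvPolynomial.map (Polynomial.evalRingHom x₀) (form (e.symm q))) =
        MvPolynomial.map (Polynomial.evalRingHom x₀)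
          ((∏ a, (baseForm a : MvPolynomial (Fin (h + h)) (Polynomial ℂ))) * ∏ j', G j') := by
      rw [← hprodform, map_prod]
      exact Fintype.prod_equiv e.symm _ _ (fun q => rfl)
    have hmat : (Matrix.of fun i j : Fin r => MvPolynomial.coeff (∑ a ∈ u i, Finsupp.single (Fin.castAdd h a) 1 +
          ∑ c ∈ w j, Finsupp.single (Fin.natAdd h c) 1)
        (∏ q, MvPolynomial.map (Polynomial.evalRingHom x₀) (form (e.symm q)))) =
        (Polynomial.evalRingHom x₀).mapMatrix
          (pmat u w ((∏ a, (baseForm a : MvPolynomial (Fin (h + h)) (Polynomial ℂ))) * ∏ j', G j')) := by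
      ext i j
      rw [Matrix.of_apply, hprod, coeff_map, RingHom.mapMatrix_apply, Matrix.map_apply, ChowShift.pmat_apply]
    rw [hmat, ← RingHom.map_det, Polynomial.coe_evalRingHom]
    exact hx₀

end

end Summit.ValiantsHypothesis.ValiantsHypothesis.Theorems.BarrierLever.ChowHybrid
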